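import Literature.NumberTheory.EllipticCurves.ModularSymbolsHeckeProofs
import Literature.NumberTheory.EllipticCurves.NewformsLevelLowering
import HarnessLib

/-!
# Twists of cusp forms on `Γ₀(N)` by Dirichlet characters (Shimura 1971, Prop. 3.64)

For a cusp form `f = ∑ aₙ qⁿ ∈ S_k(Γ₀(N))` and a Dirichlet character `χ` modulo `m`, the **twist**
of `f` by `χ` is the cusp form with `q`-expansion `f_χ = ∑ χ(n) aₙ qⁿ`. Shimura 1971, Prop. 3.64
constructs it as the finite linear combination of translates

`f_χ(τ) = g(χ̄)⁻¹ ∑_{u mod m} χ̄(u) f(τ + u/m)`,   `g(χ̄) = ∑_u χ̄(u) e^{2πiu/m}` the Gauss sum,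

(valid for `χ` primitive, by the separability `∑_u χ̄(u) e^{2πiun/m} = χ(n) g(χ̄)` of Gauss sums of
primitive characters) and shows that `f_χ` is a cusp form of level `Γ₀(L)` with character `χ²` for any
`L` divisible by `N` and `m²` (Shimura: level `lcm(N, m²)`, his `M = lcm(N, r², r 𝔣_ψ)` with trivial
`ψ`). This file formalises the construction:

* `twistT u = [1, u/m; 0, 1]` and the matrix identity behind everything
  (`exists_twistT_mul_mapGL_eq`): for `γ = (a b; c d) ∈ SL(2, ℤ)` with `m² ∣ c`,
  `[1, u/m; 0, 1] γ = γ' [1, d²u/m; 0, 1]` with `γ' ∈ SL(2, ℤ)` having the same lower-left entry `c`;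
* `twistTranslate L f u`, the translate `f(τ + u/m)` as a cusp form on `Γ₁(L)` (`N ∣ L`, `m² ∣ L`);
* `twistRaw L f χ = ∑_u χ⁻¹(u) • f(τ + u/m) ∈ S_k(Γ₁(L))` and its transformation law under
  `Γ₀(L)`: `twistRaw ∣[k] γ = χ(d)² • twistRaw` (`coe_twistRaw_slash`);
* for `χ` quadratic (`χ² = 1`, the case of the quadratic twists of elliptic curves) the **twist**
  `charTwist L hN hm hχ f = g(χ⁻¹)⁻¹ • twistRaw ∈ S_k(Γ₀(L))`;
* the `q`-expansions `aₙ(twistRaw) = χ(n) g(χ⁻¹) aₙ(f)` and `aₙ(charTwist f) = χ(n) aₙ(f)` for primitive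
  `χ` (`cuspCoeff_twistRaw`, `cuspCoeff_charTwist`), the non-vanishing `g(χ) ≠ 0` of the Gauss sum of a
  primitive character of any modulus (`gaussSum_stdAddChar_ne_zero_of_isPrimitive`, by Fourier
  inversion on `ℤ/mℤ`), and `L(charTwist f χ, s) = L(f ⊗ χ, s)` (`cuspFormLSeries_charTwist`, the tree's
  `twistedLSeries`).

Everything is proved; there are no new named facts. The Atkin–Lehner eigenvalue of a quadratic
twist (Atkin–Lehner 1970, §6; Atkin–Li 1978) is treated in the sibling
`CuspFormTwistAtkinLehnerProofs`.

## Implementation notes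

* The translates `f(τ + u/m)` are Mathlib's `CuspForm.translate` (`translateCuspForm` of
  `ModularSymbolsHeckeProofs`, whose `q`-expansion `aₙ(f_{u/m}) = e^{2πinu/m} aₙ(f)` is
  `cuspCoeff_translateCuspForm`); they live on conjugate subgroups, so each is first moved to the
  common level `Γ₁(L)` (`cuspFormOfInvariant` of `NewformsLevelLowering`: the cusps of all arithmetic
  groups agree), where the character-weighted sum is formed; the sum is `Γ₀(L)`-semi-invariant with
  multiplier `χ(d)²`, hence a cusp form on `Γ₀(L)` when `χ` is quadratic.
* `u : ZMod m` is represented by `u.val ∈ [0, m)`, `twistShift u = u.val / m ∈ ℚ`.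
* The name is `charTwist` because `twist` is taken (`ModularFormsGamma0Genus`, an unrelated
  exponential factor).
* Junk values: `charTwist` is `0` if `g(χ⁻¹) = 0` (impossible for primitive `χ`, possible for
  imprimitive ones); all statements about `q`-expansions assume `χ` primitive.

## References

* G. Shimura, *Introduction to the arithmetic theory of automorphic functions*, Iwanami Shoten /
  Princeton UP 1971, Prop. 3.64 (twists `f_χ` of modular forms by primitive characters), Thm. 3.66.
* A. O. L. Atkin, J. Lehner, *Hecke operators on `Γ₀(m)`*, Math. Ann. 185 (1970), 134–160, §6.
* A. O. L. Atkin, W.-C. W. Li, *Twists of newforms and pseudo-eigenvalues of `W`-operators*,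
  Invent. Math. 48 (1978), 221–243, §3.
* H. Iwaniec, *Topics in classical automorphic forms*, GSM 17, AMS 1997, §7.3.
-/

noncomputable section

open scoped MatrixGroups ModularForm Real

open CongruenceSubgroup Matrix.SpecialLinearGroup Matrix.GeneralLinearGroup UpperHalfPlane Complex

namespace Literature.NumberTheory.EllipticCurves.ModularForms

/-! ### Translation matrices `[1, u/m; 0, 1]` and the basic commutation relation -/

section Matrices

variable {m : ℕ}

/-- The shift `u/m ∈ ℚ` attached to a residue `u mod m`, represented by `u.val ∈ [0, m)`.
[folklore] -/
def twistShift (u : ZMod m) : ℚ := (u.val : ℚ) / m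

/-- The translation `[1, u/m; 0, 1] ∈ GL(2, ℝ)` by `u/m` (`u mod m`), acting on `ℍ` by
`τ ↦ τ + u/m`. [folklore] -/
def twistT (u : ZMod m) : GL (Fin 2) ℝ := upperRightHom ((twistShift u : ℚ) : ℝ)

/-- `twistShift u = u.val / m` as a real number. [folklore] -/
theorem ratCast_twistShift (u : ZMod m) : ((twistShift u : ℚ) : ℝ) = (u.val : ℝ) / m := by
  rw [twistShift]
  push_cast
  rfl

/-- The matrix of `twistT u` is `(1 u/m; 0 1)`. [folklore] -/
theorem val_twistT (u : ZMod m) :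
    ((twistT u : GL (Fin 2) ℝ) : Matrix (Fin 2) (Fin 2) ℝ) = !![1, (u.val : ℝ) / m; 0, 1] := by
  rw [twistT, ← ratCast_twistShift]
  simp [upperRightHom]

/-- `det [1, u/m; 0, 1] = 1 > 0`. [folklore] -/
theorem det_twistT_pos (u : ZMod m) : 0 < (twistT u).det.val := by
  rw [Matrix.GeneralLinearGroup.val_det_apply, val_twistT, Matrix.det_fin_two_of]
  norm_num

/-- `σ (twistT u)` is the identity (positive determinant). [folklore] -/
@[simp] theorem σ_twistT (u : ZMod m) (z : ℂ) : σ (twistT u) z = z :=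
  σ_eq_self (det_twistT_pos u) z

/-- The slash action of `twistT u` is translation of the argument: `(f ∣[k] [1,u/m;0,1])(τ) = f(u/m + τ)`.
[folklore] -/
theorem slash_twistT_apply (f : ℍ → ℂ) (k : ℤ) (u : ZMod m) (τ : ℍ) :
    (f ∣[k] twistT u) τ = f ((((twistShift u : ℚ) : ℝ)) +ᵥ τ) :=
  slash_upperRightHom_apply f k _ τ

/-- If `m ∣ c` for the lower-left entry `c` of `γ ∈ SL(2, ℤ)`, then the diagonal entries of `γ`
are units modulo `m` (`ad ≡ 1 mod m`). [folklore] -/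
theorem natCast_mul_natCast_eq_one_of_dvd (γ : SL(2, ℤ)) (h : (m : ℤ) ∣ γ 1 0) :
    ((γ 0 0 : ℤ) : ZMod m) * ((γ 1 1 : ℤ) : ZMod m) = 1 := by
  obtain ⟨c₀, hc₀⟩ := h
  have hdet := det_entries γ
  have : (((γ 0 0 * γ 1 1 : ℤ)) : ZMod m) = (((1 + γ 0 1 * (m * c₀) : ℤ)) : ZMod m) := by
    rw [← hc₀]
    congr 1
    linear_combination hdet
  push_cast at this
  simpa [ZMod.natCast_self] using this

/-- Under `m ∣ c`, the lower-right entry `d` of `γ ∈ SL(2, ℤ)` is a unit modulo `m`. [folklore] -/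
theorem isUnit_intCast_entry_of_dvd (γ : SL(2, ℤ)) (h : (m : ℤ) ∣ γ 1 0) :
    IsUnit (((γ 1 1 : ℤ) : ZMod m)) :=
  IsUnit.of_mul_eq_one_right _ (natCast_mul_natCast_eq_one_of_dvd γ h)

/-- **The commutation relation behind twisting** (Shimura 1971, proof of Prop. 3.64): for
`γ = (a b; c d) ∈ SL(2, ℤ)` with `m² ∣ c` and `u mod m`,
`[1, u/m; 0, 1] γ = γ' [1, v/m; 0, 1]` with `v ≡ d² u (mod m)` and `γ' ∈ SL(2, ℤ)` with the same
lower-left entry `c` (so `γ' ∈ Γ₀(N)` whenever `γ ∈ Γ₀(N)`). Explicitly, with `c = m² c₂`,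
`U = u.val`, `V = v.val` and `m t = dU − aV`,
`γ' = (a + m c₂ U, b + t − c₂ U V; c, d − m c₂ V)`. [cite: Shimura1971, Prop. 3.64] -/
theorem exists_twistT_mul_mapGL_eq [NeZero m] (γ : SL(2, ℤ)) (hc : ((m : ℤ) ^ 2) ∣ γ 1 0)
    (u : ZMod m) :
    ∃ γ' : SL(2, ℤ), γ' 1 0 = γ 1 0 ∧
      twistT u * (mapGL ℝ γ : GL (Fin 2) ℝ) =
        (mapGL ℝ γ' : GL (Fin 2) ℝ) * twistT ((((γ 1 1 : ℤ) : ZMod m)) ^ 2 * u) := by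
  obtain ⟨c₂, hc₂⟩ := hc
  set a := γ 0 0 with ha
  set b := γ 0 1 with hb
  set c := γ 1 0 with hc
  set d := γ 1 1 with hd
  set v : ZMod m := ((d : ZMod m)) ^ 2 * u with hv
  set U : ℤ := (u.val : ℤ) with hU
  set V : ℤ := (v.val : ℤ) with hV
  have hm0 : (m : ℝ) ≠ 0 := by exact_mod_cast NeZero.ne m
  have hdet : a * d - b * (m ^ 2 * c₂) = 1 := by
    have := det_entries γ
    rw [← hc₂]
    linear_combination this
  have hmc : (m : ℤ) ∣ γ 1 0 := ⟨m * c₂, by rw [← hc, hc₂]; ring⟩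
  have had : (a : ZMod m) * (d : ZMod m) = 1 := natCast_mul_natCast_eq_one_of_dvd γ hmc
  -- `m ∣ dU - aV`
  have hdvd : (m : ℤ) ∣ d * U - a * V := by
    rw [← ZMod.intCast_zmod_eq_zero_iff_dvd]
    have hUc : ((U : ℤ) : ZMod m) = u := by simp [hU]
    have hVc : ((V : ℤ) : ZMod m) = v := by simp [hV]
    push_cast
    rw [hUc, hVc, hv]
    linear_combination (-((d : ZMod m) * u)) * had
  obtain ⟨t, ht⟩ := hdvd
  let A : Matrix (Fin 2) (Fin 2) ℤ :=
    !![a + m * c₂ * U, b + t - c₂ * U * V; m ^ 2 * c₂, d - m * c₂ * V]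
  have hA : A.det = 1 := by
    rw [Matrix.det_fin_two_of]
    linear_combination hdet + m * c₂ * ht
  refine ⟨⟨A, hA⟩, ?_, ?_⟩
  · change A 1 0 = c
    simp [A, hc₂]
  · refine Units.ext ?_
    simp only [Matrix.GeneralLinearGroup.coe_mul, val_twistT, val_mapGL']
    have hUr : ((u.val : ℕ) : ℝ) = (U : ℝ) := by rw [hU]; push_cast; rfl
    have hVr : ((v.val : ℕ) : ℝ) = (V : ℝ) := by rw [hV]; push_cast; rfl
    have hcr : ((γ 1 0 : ℤ) : ℝ) = (m : ℝ) ^ 2 * c₂ := by rw [← hc, hc₂]; push_cast; ring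
    have htr : (d : ℝ) * U - a * V = m * t := by exact_mod_cast ht
    rw [hUr, hVr]
    ext i j
    fin_cases i <;> fin_cases j <;>
      simp [Matrix.mul_apply, Fin.sum_univ_two, A, hcr, ← ha, ← hb, ← hd] <;> field_simp <;>
      (first | ring1 | linear_combination htr)

end Matrices

/-! ### The translates and the raw twist on `Γ₁(L)` -/

section Raw

variable {N : ℕ} {k : ℤ} {m : ℕ}

/-- The underlying function of the translate `f_q` is `f ∣[k] [1, q; 0, 1]`. [folklore] -/
theorem coe_translateCuspForm {Γ : Subgroup (GL (Fin 2) ℝ)} (f : CuspForm Γ k) (q : ℚ) :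
    (⇑(translateCuspForm f q) : ℍ → ℂ) = (⇑f : ℍ → ℂ) ∣[k] (upperRightHom (q : ℝ) : GL (Fin 2) ℝ) :=
  rfl

/-- A matrix of `SL(2, ℤ)` whose lower-left entry is that of an element of `Γ₀(L)`, `N ∣ L`, lies in
`Γ₀(N)`. [folklore] -/
theorem mem_Gamma0_of_entry_eq {L : ℕ} (hN : N ∣ L) {γ γ' : SL(2, ℤ)} (hγ : γ ∈ Gamma0 L)
    (h : γ' 1 0 = γ 1 0) : γ' ∈ Gamma0 N := by
  rw [Gamma0_mem, h, ZMod.intCast_zmod_eq_zero_iff_dvd]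
  exact (Int.natCast_dvd_natCast.mpr hN).trans (dvd_entry_of_mem_Gamma0 L hγ)

/-- For `γ ∈ Γ₀(L)` with `m² ∣ L`: `m² ∣ c`. [folklore] -/
theorem sq_dvd_entry_of_mem_Gamma0 {L : ℕ} (hm : m ^ 2 ∣ L) {γ : SL(2, ℤ)} (hγ : γ ∈ Gamma0 L) :
    ((m : ℤ) ^ 2) ∣ γ 1 0 :=
  (by exact_mod_cast hm : ((m : ℤ) ^ 2) ∣ (L : ℤ)).trans (dvd_entry_of_mem_Gamma0 L hγ)

/-- **Slashing a `Γ₀(N)`-invariant function translated by `u/m` with `γ ∈ Γ₀(L)`** (`N ∣ L`,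
`m² ∣ L`): `(f ∣ [1,u/m;0,1]) ∣ γ = f ∣ [1, d²u/m; 0, 1]` (Shimura 1971, proof of Prop. 3.64).
[cite: Shimura1971, Prop. 3.64] -/
theorem slash_twistT_slash_mapGL [NeZero m] {L : ℕ} (hN : N ∣ L) (hm : m ^ 2 ∣ L)
    (f : CuspForm (Gamma0 N) k) {γ : SL(2, ℤ)} (hγ : γ ∈ Gamma0 L) (u : ZMod m) :
    ((⇑f : ℍ → ℂ) ∣[k] twistT u) ∣[k] (mapGL ℝ γ : GL (Fin 2) ℝ) =
      (⇑f : ℍ → ℂ) ∣[k] twistT ((((γ 1 1 : ℤ) : ZMod m)) ^ 2 * u) := by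
  obtain ⟨γ', hγ'c, h⟩ := exists_twistT_mul_mapGL_eq γ (sq_dvd_entry_of_mem_Gamma0 hm hγ) u
  have hmem : (mapGL ℝ γ' : GL (Fin 2) ℝ) ∈
      ((Gamma0 N : Subgroup SL(2, ℤ)) : Subgroup (GL (Fin 2) ℝ)) :=
    ⟨γ', mem_Gamma0_of_entry_eq hN hγ hγ'c, rfl⟩
  rw [← SlashAction.slash_mul, h, SlashAction.slash_mul,
    SlashInvariantFormClass.slash_action_eq f _ hmem]

variable [NeZero N] [NeZero m] (L : ℕ) [NeZero L]

/-- The translate `f(τ + u/m)` of `f ∈ S_k(Γ₀(N))`, `u mod m`, as a **cusp form on `Γ₁(L)`** for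
`N ∣ L`, `m² ∣ L`: for `γ ∈ Γ₁(L)` one has `d ≡ 1 (mod m)`, so `[1,u/m;0,1] γ = γ' [1,u/m;0,1]` with
`γ' ∈ Γ₀(N)` (`exists_twistT_mul_mapGL_eq`) (Shimura 1971, proof of Prop. 3.64). The underlying
function is that of `translateCuspForm f (u/m)` (Mathlib `CuspForm.translate`).
[cite: Shimura1971, Prop. 3.64] -/
def twistTranslate (hN : N ∣ L) (hm : m ^ 2 ∣ L) (f : CuspForm (Gamma0 N) k) (u : ZMod m) :
    CuspForm (Gamma1 L) k :=
  cuspFormOfInvariant (translateCuspForm f (twistShift u)) fun g hg ↦ by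
    obtain ⟨γ, hγ, rfl⟩ := hg
    have hγ0 : γ ∈ Gamma0 L := Gamma1_in_Gamma0 L hγ
    have hd : (((γ 1 1 : ℤ) : ZMod m)) = 1 := by
      have h1 : (((γ 1 1 : ℤ) : ZMod L)) = 1 := ((Gamma1_mem L γ).mp hγ).2.1
      have hmL : m ∣ L := (Dvd.intro_left _ (sq m).symm).trans hm
      have h2 := congrArg (ZMod.castHom hmL (ZMod m)) h1
      rwa [map_intCast, map_one] at h2
    rw [coe_translateCuspForm, show (upperRightHom ((twistShift u : ℚ) : ℝ) : GL (Fin 2) ℝ) =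
      twistT u from rfl, slash_twistT_slash_mapGL hN hm f hγ0 u, hd, one_pow, one_mul]

/-- `twistTranslate L hN hm f u` is the function `f ∣[k] [1, u/m; 0, 1]`, i.e. `τ ↦ f(τ + u/m)`.
[folklore] -/
@[simp] theorem coe_twistTranslate (hN : N ∣ L) (hm : m ^ 2 ∣ L) (f : CuspForm (Gamma0 N) k)
    (u : ZMod m) : (⇑(twistTranslate L hN hm f u) : ℍ → ℂ) = (⇑f : ℍ → ℂ) ∣[k] twistT u :=
  rfl

/-- The **raw twist** `∑_{u mod m} χ⁻¹(u) f(τ + u/m)` of `f ∈ S_k(Γ₀(N))` by a Dirichlet character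
`χ mod m`, as a cusp form on `Γ₁(L)` (`N ∣ L`, `m² ∣ L`); for primitive `χ` it is
`g(χ⁻¹) · ∑ χ(n) aₙ qⁿ` (`cuspCoeff_twistRaw`) (Shimura 1971, Prop. 3.64, the function
`∑_u χ̄(u) f(z + u/r)`). [cite: Shimura1971, Prop. 3.64] -/
def twistRaw (hN : N ∣ L) (hm : m ^ 2 ∣ L) (f : CuspForm (Gamma0 N) k) (χ : DirichletCharacter ℂ m) :
    CuspForm (Gamma1 L) k :=
  ∑ u : ZMod m, χ⁻¹ u • twistTranslate L hN hm f u

/-- The underlying function of the raw twist: `∑_u χ⁻¹(u) • (f ∣[k] [1, u/m; 0, 1])`. [folklore] -/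
theorem coe_twistRaw (hN : N ∣ L) (hm : m ^ 2 ∣ L) (f : CuspForm (Gamma0 N) k)
    (χ : DirichletCharacter ℂ m) :
    (⇑(twistRaw L hN hm f χ) : ℍ → ℂ) =
      ∑ u : ZMod m, χ⁻¹ u • ((⇑f : ℍ → ℂ) ∣[k] twistT u) := by
  have h := map_sum (CuspForm.coeHom (Γ := ((Gamma1 L : Subgroup SL(2, ℤ)) : Subgroup (GL (Fin 2) ℝ)))
    (k := k)) (fun u : ZMod m ↦ χ⁻¹ u • twistTranslate L hN hm f u) Finset.univ
  rw [twistRaw]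
  refine h.trans (Finset.sum_congr rfl fun u _ ↦ ?_)
  rfl

end Raw

/-! ### The transformation law of the raw twist under `Γ₀(L)` and the twist on `Γ₀(L)` -/

section SlashLaw

variable {N : ℕ} [NeZero N] {k : ℤ} {m : ℕ} [NeZero m] (L : ℕ) [NeZero L]

omit [NeZero N] [NeZero m] [NeZero L] in
/-- Finite sums commute with the slash action. [folklore] -/
theorem finset_sum_slash {ι : Type*} (s : Finset ι) (F : ι → ℍ → ℂ) (k : ℤ) (g : GL (Fin 2) ℝ) :
    (∑ i ∈ s, F i) ∣[k] g = ∑ i ∈ s, F i ∣[k] g := by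
  classical
  induction s using Finset.induction_on with
  | empty => simp [SlashAction.zero_slash]
  | insert i s hi ih => rw [Finset.sum_insert hi, Finset.sum_insert hi, SlashAction.add_slash, ih]

omit [NeZero N] [NeZero m] [NeZero L] in
/-- `σ (mapGL ℝ γ)` is the identity for `γ ∈ SL(2, ℤ)`. [folklore] -/
theorem σ_mapGL (γ : SL(2, ℤ)) (z : ℂ) : σ (mapGL ℝ γ : GL (Fin 2) ℝ) z = z :=
  σ_eq_self (by simp [Matrix.SpecialLinearGroup.det_mapGL]) z

/-- **Transformation law of the raw twist** (Shimura 1971, Prop. 3.64: `f_χ ∈ S_k(Γ₀(M), ψχ²)`):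
for `γ = (a b; c d) ∈ Γ₀(L)`, `N ∣ L`, `m² ∣ L`,
`(∑_u χ⁻¹(u) f(· + u/m)) ∣[k] γ = χ(d)² • ∑_u χ⁻¹(u) f(· + u/m)`: slashing permutes the translates
(`u ↦ d²u`, `slash_twistT_slash_mapGL`) and `χ⁻¹(d⁻² w) = χ(d)² χ⁻¹(w)`.
[cite: Shimura1971, Prop. 3.64] -/
theorem coe_twistRaw_slash (hN : N ∣ L) (hm : m ^ 2 ∣ L) (f : CuspForm (Gamma0 N) k)
    (χ : DirichletCharacter ℂ m) {γ : SL(2, ℤ)} (hγ : γ ∈ Gamma0 L) :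
    (⇑(twistRaw L hN hm f χ) : ℍ → ℂ) ∣[k] (mapGL ℝ γ : GL (Fin 2) ℝ) =
      (χ (((γ 1 1 : ℤ) : ZMod m))) ^ 2 • (⇑(twistRaw L hN hm f χ) : ℍ → ℂ) := by
  have hunit : IsUnit (((γ 1 1 : ℤ) : ZMod m)) :=
    isUnit_intCast_entry_of_dvd γ
      ((dvd_pow_self (m : ℤ) two_ne_zero).trans (sq_dvd_entry_of_mem_Gamma0 hm hγ))
  obtain ⟨dU, hdU⟩ := hunit
  rw [coe_twistRaw, finset_sum_slash]
  have h1 : ∀ u : ZMod m, (χ⁻¹ u • ((⇑f : ℍ → ℂ) ∣[k] twistT u)) ∣[k] (mapGL ℝ γ : GL (Fin 2) ℝ) =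
      χ⁻¹ u • ((⇑f : ℍ → ℂ) ∣[k] twistT (((dU ^ 2 : (ZMod m)ˣ) : ZMod m) * u)) := by
    intro u
    rw [ModularForm.smul_slash, σ_mapGL, slash_twistT_slash_mapGL hN hm f hγ u, ← hdU,
      Units.val_pow_eq_pow_val]
  simp_rw [h1]
  rw [Fintype.sum_equiv (Units.mulLeft (dU ^ 2))
    (fun u : ZMod m ↦ χ⁻¹ u • ((⇑f : ℍ → ℂ) ∣[k] twistT (((dU ^ 2 : (ZMod m)ˣ) : ZMod m) * u)))
    (fun w : ZMod m ↦ χ⁻¹ ((((dU ^ 2)⁻¹ : (ZMod m)ˣ) : ZMod m) * w) • ((⇑f : ℍ → ℂ) ∣[k] twistT w))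
    (fun u ↦ by rw [Units.mulLeft_apply, Units.inv_mul_cancel_left]), Finset.smul_sum]
  refine Finset.sum_congr rfl fun w _ ↦ ?_
  rw [smul_smul, map_mul, MulChar.inv_apply, Ring.inverse_unit, inv_inv, ← hdU,
    Units.val_pow_eq_pow_val, map_pow]

/-- For a quadratic character `χ` (`χ² = 1`) and a unit `a`, `χ(a)² = 1`. [folklore] -/
theorem apply_sq_eq_one_of_isQuadratic {R : Type*} [CommMonoid R] {R' : Type*}
    [CommRing R'] {χ : MulChar R R'} (hχ : χ.IsQuadratic) {a : R} (ha : IsUnit a) :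
    χ a ^ 2 = 1 := by
  obtain ⟨u, rfl⟩ := ha
  rw [← MulChar.pow_apply_coe, hχ.sq_eq_one, MulChar.one_apply_coe]

/-- **The twist `f_χ ∈ S_k(Γ₀(L))` of `f ∈ S_k(Γ₀(N))` by a quadratic Dirichlet character `χ mod m`**
(`N ∣ L`, `m² ∣ L`): `f_χ = g(χ⁻¹)⁻¹ ∑_{u mod m} χ⁻¹(u) f(τ + u/m)`, `g(χ⁻¹) = ∑_u χ⁻¹(u) e^{2πiu/m}`,
with `q`-expansion `∑ χ(n) aₙ(f) qⁿ` when `χ` is primitive (`cuspCoeff_charTwist`) (Shimura 1971,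
Prop. 3.64, the case `ψ = 1`, `χ² = 1` of "`f_χ ∈ S_k(Γ₀(M), ψχ²)`, `M = lcm(N, r², r𝔣_ψ)`"; the
modular form side of the quadratic twist `E ↦ E^χ` of elliptic curves). It is `Γ₀(L)`-invariant by
`coe_twistRaw_slash` (`χ(d)² = 1`). Junk value `0` if `g(χ⁻¹) = 0` (which does not happen for
primitive `χ`, `gaussSum_stdAddChar_ne_zero_of_isPrimitive`). [cite: Shimura1971, Prop. 3.64] -/
def charTwist (hN : N ∣ L) (hm : m ^ 2 ∣ L) {χ : DirichletCharacter ℂ m} (hχ : χ.IsQuadratic)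
    (f : CuspForm (Gamma0 N) k) : CuspForm (Gamma0 L) k :=
  cuspFormOfInvariant ((gaussSum χ⁻¹ (ZMod.stdAddChar (N := m)))⁻¹ • twistRaw L hN hm f χ)
    fun g hg ↦ by
      obtain ⟨γ, hγ, rfl⟩ := hg
      have hsq : (χ (((γ 1 1 : ℤ) : ZMod m))) ^ 2 = 1 :=
        apply_sq_eq_one_of_isQuadratic hχ (isUnit_intCast_entry_of_dvd γ
          ((dvd_pow_self (m : ℤ) two_ne_zero).trans (sq_dvd_entry_of_mem_Gamma0 hm hγ)))
      rw [CuspForm.IsGLPos.coe_smul, ModularForm.smul_slash, σ_mapGL, coe_twistRaw_slash L hN hm f χ hγ,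
        hsq, one_smul]

/-- The underlying function of the twist: `g(χ⁻¹)⁻¹ • ∑_u χ⁻¹(u) • (f ∣[k] [1, u/m; 0, 1])`.
[folklore] -/
theorem coe_charTwist (hN : N ∣ L) (hm : m ^ 2 ∣ L) {χ : DirichletCharacter ℂ m} (hχ : χ.IsQuadratic)
    (f : CuspForm (Gamma0 N) k) :
    (⇑(charTwist L hN hm hχ f) : ℍ → ℂ) =
      (gaussSum χ⁻¹ (ZMod.stdAddChar (N := m)))⁻¹ • (⇑(twistRaw L hN hm f χ) : ℍ → ℂ) :=
  rfl

/-- The raw twist is additive in `f`. [folklore] -/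
theorem twistRaw_add (hN : N ∣ L) (hm : m ^ 2 ∣ L) (f g : CuspForm (Gamma0 N) k)
    (χ : DirichletCharacter ℂ m) :
    twistRaw L hN hm (f + g) χ = twistRaw L hN hm f χ + twistRaw L hN hm g χ := by
  apply DFunLike.coe_injective
  rw [CuspForm.coe_add, coe_twistRaw, coe_twistRaw, coe_twistRaw, ← Finset.sum_add_distrib]
  refine Finset.sum_congr rfl fun u _ ↦ ?_
  rw [CuspForm.coe_add, SlashAction.add_slash, smul_add]

/-- The raw twist is homogeneous in `f`. [folklore] -/
theorem twistRaw_smul (hN : N ∣ L) (hm : m ^ 2 ∣ L) (c : ℂ) (f : CuspForm (Gamma0 N) k)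
    (χ : DirichletCharacter ℂ m) :
    twistRaw L hN hm (c • f) χ = c • twistRaw L hN hm f χ := by
  apply DFunLike.coe_injective
  rw [CuspForm.IsGLPos.coe_smul, coe_twistRaw, coe_twistRaw, Finset.smul_sum]
  refine Finset.sum_congr rfl fun u _ ↦ ?_
  rw [CuspForm.IsGLPos.coe_smul, ModularForm.smul_slash, σ_twistT, smul_comm]

end SlashLaw

/-! ### `q`-expansions -/

section QExpansion

variable {N : ℕ} [NeZero N] {k : ℤ} {m : ℕ} [NeZero m] (L : ℕ) [NeZero L]

omit [NeZero N] [NeZero L] in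
/-- **The Gauss sum of a primitive Dirichlet character does not vanish** (any modulus): the
discrete Fourier transform of `χ` is `𝓕χ(a) = χ⁻¹(−a) g(χ)` (Mathlib
`DirichletCharacter.IsPrimitive.fourierTransform_eq_inv_mul_gaussSum`), so `g(χ) = 0` would force
`𝓕χ = 0`, hence `χ = 0` by Fourier inversion, contradicting `χ(1) = 1` (classically `|g(χ)|² = m`
for primitive `χ`; only the non-vanishing is needed here). [folklore] -/
theorem gaussSum_stdAddChar_ne_zero_of_isPrimitive {χ : DirichletCharacter ℂ m}
    (hχ : χ.IsPrimitive) : gaussSum χ (ZMod.stdAddChar (N := m)) ≠ 0 := by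
  intro h
  have h1 : ZMod.dft (⇑χ) = 0 := by
    funext a
    rw [hχ.fourierTransform_eq_inv_mul_gaussSum, h, mul_zero, Pi.zero_apply]
  have h2 : (⇑χ : ZMod m → ℂ) = 0 := by
    have := congrArg ZMod.dft.symm h1
    rwa [LinearEquiv.symm_apply_apply, map_zero] at this
  have h3 := congrFun h2 1
  rw [map_one, Pi.zero_apply] at h3
  exact one_ne_zero h3

omit [NeZero N] [NeZero m] [NeZero L] in
/-- The inverse of a primitive character is primitive. [folklore] -/
theorem isPrimitive_inv {χ : DirichletCharacter ℂ m} (hχ : χ.IsPrimitive) :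
    χ⁻¹.IsPrimitive := by
  rw [DirichletCharacter.isPrimitive_def, DirichletCharacter.conductor_inv]
  exact hχ

/-- **`q`-expansion of the raw twist at `τ`**: `∑_u χ⁻¹(u) f(τ + u/m) = ∑_n (∑_u χ⁻¹(u) e^{2πinu/m}) aₙ qⁿ`
(Shimura 1971, proof of Prop. 3.64). [cite: Shimura1971, Prop. 3.64] -/
theorem hasSum_twistRaw (hN : N ∣ L) (hm : m ^ 2 ∣ L) (f : CuspForm (Gamma0 N) k)
    (χ : DirichletCharacter ℂ m) (τ : ℍ) :
    HasSum (fun n : ℕ ↦ ((∑ u : ZMod m, χ⁻¹ u * (ZMod.stdAddChar (u * (n : ZMod m)) : ℂ)) *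
        cuspCoeff f n) • Function.Periodic.qParam 1 (τ : ℂ) ^ n) (twistRaw L hN hm f χ τ) := by
  have hΓ : (1 : ℝ) ∈ ((Gamma0 N : Subgroup SL(2, ℤ)) : Subgroup (GL (Fin 2) ℝ)).strictPeriods :=
    strictWidthInfty_Gamma0 N ▸ Subgroup.strictWidthInfty_mem_strictPeriods _
  have hu : ∀ u : ZMod m, HasSum (fun n : ℕ ↦ (χ⁻¹ u * ((ZMod.stdAddChar (u * (n : ZMod m)) : ℂ) *
      cuspCoeff f n)) • Function.Periodic.qParam 1 (τ : ℂ) ^ n)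
      (χ⁻¹ u * f ((((twistShift u : ℚ) : ℝ)) +ᵥ τ)) := by
    intro u
    have h := UpperHalfPlane.hasSum_qExpansion one_pos
      (SlashInvariantFormClass.periodic_comp_ofComplex f hΓ) (ModularFormClass.holo f)
      (ModularFormClass.bdd_at_infty f) ((((twistShift u : ℚ) : ℝ)) +ᵥ τ)
    have h' : HasSum (fun n : ℕ ↦ (((ZMod.stdAddChar (u * (n : ZMod m)) : ℂ) * cuspCoeff f n)) •
        Function.Periodic.qParam 1 (τ : ℂ) ^ n) (f ((((twistShift u : ℚ) : ℝ)) +ᵥ τ)) := by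
      convert h using 2 with n
      rw [qParam_vadd, mul_pow, smul_eq_mul, smul_eq_mul, cuspCoeff, ← Complex.exp_nat_mul,
        stdAddChar_mul_natCast]
      rw [show ((((u.val : ℚ) / m : ℚ)) : ℂ) = ((((twistShift u : ℚ) : ℝ)) : ℂ) by
        rw [twistShift]; push_cast; rfl]
      ring_nf
    simpa only [smul_eq_mul, mul_assoc] using h'.mul_left (χ⁻¹ u)
  have hsum := hasSum_sum (s := (Finset.univ : Finset (ZMod m))) fun u _ ↦ hu u
  have hval : twistRaw L hN hm f χ τ = ∑ u : ZMod m, χ⁻¹ u * f ((((twistShift u : ℚ) : ℝ)) +ᵥ τ) := by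
    rw [show twistRaw L hN hm f χ τ = (⇑(twistRaw L hN hm f χ) : ℍ → ℂ) τ from rfl, coe_twistRaw,
      Finset.sum_apply]
    refine Finset.sum_congr rfl fun u _ ↦ ?_
    rw [Pi.smul_apply, slash_twistT_apply, smul_eq_mul]
  rw [hval]
  convert hsum using 1
  funext n
  rw [← Finset.sum_smul, Finset.sum_mul]
  refine congrArg (· • _) (Finset.sum_congr rfl fun u _ ↦ ?_)
  ring

/-- **`q`-expansion of the raw twist by a primitive character**:
`aₙ(∑_u χ⁻¹(u) f(· + u/m)) = χ(n) g(χ⁻¹) aₙ(f)` (Shimura 1971, Prop. 3.64 with Lemma 3.63, the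
separability `∑_u χ̄(u) e^{2πinu/m} = χ(n) g(χ̄)` of the Gauss sum of a primitive character, Mathlib
`gaussSum_mulShift_of_isPrimitive`). [cite: Shimura1971, Prop. 3.64] -/
theorem cuspCoeff_twistRaw (hN : N ∣ L) (hm : m ^ 2 ∣ L) (f : CuspForm (Gamma0 N) k)
    {χ : DirichletCharacter ℂ m} (hχ : χ.IsPrimitive) (n : ℕ) :
    cuspCoeff (twistRaw L hN hm f χ) n =
      χ n * gaussSum χ⁻¹ (ZMod.stdAddChar (N := m)) * cuspCoeff f n := by
  have hΓ' : (1 : ℝ) ∈ ((Gamma1 L : Subgroup SL(2, ℤ)) : Subgroup (GL (Fin 2) ℝ)).strictPeriods :=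
    strictWidthInfty_Gamma1 L ▸ Subgroup.strictWidthInfty_mem_strictPeriods _
  have hsum : ∀ τ : ℍ, HasSum (fun n : ℕ ↦ (χ n * gaussSum χ⁻¹ (ZMod.stdAddChar (N := m)) *
      cuspCoeff f n) • Function.Periodic.qParam 1 (τ : ℂ) ^ n) (twistRaw L hN hm f χ τ) := by
    intro τ
    have h := hasSum_twistRaw L hN hm f χ τ
    simp_rw [sum_inv_mul_stdAddChar_eq hχ] at h
    exact h
  rw [cuspCoeff, ← ModularFormClass.qExpansion_coeff_unique one_pos hΓ' hsum n]

/-- **`q`-expansion of the twist**: `aₙ(f_χ) = χ(n) aₙ(f)` for a primitive quadratic `χ`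
(Shimura 1971, Prop. 3.64: "`f_χ(z) = ∑ χ(n) aₙ e(nz)`"). [cite: Shimura1971, Prop. 3.64] -/
theorem cuspCoeff_charTwist (hN : N ∣ L) (hm : m ^ 2 ∣ L) {χ : DirichletCharacter ℂ m}
    (hχ : χ.IsQuadratic) (hprim : χ.IsPrimitive) (f : CuspForm (Gamma0 N) k) (n : ℕ) :
    cuspCoeff (charTwist L hN hm hχ f) n = χ n * cuspCoeff f n := by
  have hg : gaussSum χ⁻¹ (ZMod.stdAddChar (N := m)) ≠ 0 :=
    gaussSum_stdAddChar_ne_zero_of_isPrimitive (isPrimitive_inv hprim)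
  have hΓ' : (1 : ℝ) ∈ ((Gamma0 L : Subgroup SL(2, ℤ)) : Subgroup (GL (Fin 2) ℝ)).strictPeriods :=
    strictWidthInfty_Gamma0 L ▸ Subgroup.strictWidthInfty_mem_strictPeriods _
  have hsum : ∀ τ : ℍ, HasSum (fun n : ℕ ↦ (χ n * cuspCoeff f n) •
      Function.Periodic.qParam 1 (τ : ℂ) ^ n) (charTwist L hN hm hχ f τ) := by
    intro τ
    have h := (hasSum_twistRaw L hN hm f χ τ).mul_left (gaussSum χ⁻¹ (ZMod.stdAddChar (N := m)))⁻¹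
    rw [show (gaussSum χ⁻¹ (ZMod.stdAddChar (N := m)))⁻¹ * twistRaw L hN hm f χ τ =
      charTwist L hN hm hχ f τ from rfl] at h
    simp_rw [sum_inv_mul_stdAddChar_eq hprim] at h
    refine h.congr_fun fun n ↦ ?_
    simp only [smul_eq_mul]
    field_simp
  rw [cuspCoeff, ← ModularFormClass.qExpansion_coeff_unique one_pos hΓ' hsum n]

/-- **`L(f_χ, s) = L(f ⊗ χ, s)`**: the `L`-series of the twist is the twisted `L`-series
`∑ χ(n) aₙ n⁻ˢ` of the tree (`twistedLSeries`, Shimura 1971, Thm. 3.66), for a primitive quadratic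
`χ`. [cite: Shimura1971, Thm. 3.66] -/
theorem cuspFormLSeries_charTwist (hN : N ∣ L) (hm : m ^ 2 ∣ L) {χ : DirichletCharacter ℂ m}
    (hχ : χ.IsQuadratic) (hprim : χ.IsPrimitive) (f : CuspForm (Gamma0 N) k) :
    cuspFormLSeries (charTwist L hN hm hχ f) = twistedLSeries f χ := by
  funext s
  rw [cuspFormLSeries, twistedLSeries]
  congr 1
  funext n
  exact cuspCoeff_charTwist L hN hm hχ hprim f n

omit [NeZero N] [NeZero m] [NeZero L] in
/-- The Fourier coefficients of the zero form vanish (levels with strict period `1`; the tree's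
`cuspCoeff_zero` of `CuspFormLFunctionProofs` is the different statement `a₀(f) = 0`). [folklore] -/
theorem cuspCoeff_zero_form {Γ : Subgroup (GL (Fin 2) ℝ)} (hΓ : (1 : ℝ) ∈ Γ.strictPeriods) (n : ℕ) :
    cuspCoeff (0 : CuspForm Γ k) n = 0 := by
  rw [cuspCoeff, ← ModularFormClass.qExpansion_coeff_unique one_pos hΓ (f := (0 : CuspForm Γ k))
    (c := fun _ ↦ 0) (fun τ ↦ by simp) n]

/-- The twist of a form with `a₁(f) ≠ 0` (e.g. a normalised eigenform) by a primitive quadratic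
character is non-zero (`a₁(f_χ) = a₁(f)`). [folklore] -/
theorem charTwist_ne_zero (hN : N ∣ L) (hm : m ^ 2 ∣ L) {χ : DirichletCharacter ℂ m}
    (hχ : χ.IsQuadratic) (hprim : χ.IsPrimitive) {f : CuspForm (Gamma0 N) k}
    (hf : cuspCoeff f 1 ≠ 0) : charTwist L hN hm hχ f ≠ 0 := by
  intro h
  have h1 := cuspCoeff_charTwist L hN hm hχ hprim f 1
  rw [h, Nat.cast_one, map_one, one_mul,
    cuspCoeff_zero_form (strictWidthInfty_Gamma0 L ▸ Subgroup.strictWidthInfty_mem_strictPeriods _)]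
    at h1
  exact hf h1.symm

end QExpansion

end Literature.NumberTheory.EllipticCurves.ModularForms

end
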